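import Literature.MathematicalPhysics.QuantumFieldTheory.Balaban1983to89.B9Eq349ConjugatedQLetters
import Literature.MathematicalPhysics.QuantumFieldTheory.Balaban1983to89.B9Eq369CurvFormConjugation
import Literature.MathematicalPhysics.QuantumFieldTheory.Balaban1983to89.B9Eq3101ExpPointwiseMultiplier

/-!
# `Balaban1983to89.B9Eq349ConjugatedQLettersCompanion` — T. Bałaban, *Propagators for lattice gauge theories in a background field*, Commun. Math. Phys.
# **99** (1985) 389–434 [Balaban1985BackgroundPropagators] (3.15)–(3.16) p. 393, (3.26) p. 395, (3.49) p. 399, (3.69) p. 404, (3.101)–(3.103) p. 414: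
# **THE COMBES–THOMAS CONJUGATION LETTERS OF `Q(U)` AND `Δ′(U)` IN THE COMPANION SHAPE** — for every fine site weight `χ` with bond increments `≤ ι`,
# every ONE-BLOCK coarse companion `χ′` (`|χ′(y) − χ(x)| ≤ ℓ′` for `x ∈ B(y)`), the multiplier operators `M_B` (fine bonds, symbol `χ(b₋)`), `M_F`
# (coarse bonds, symbol `χ′(c₋)`) and every `κ` in the window `‖κ‖(3ℓ′ + Lι) ≤ 1`:
# `‖e^{κM_F} Q(U) e^{−κM_B} − Q(U)‖ ≤ 2‖κ‖(3ℓ′ + Lι)·M_φ′M_φ·√(2(c₁∕c₀)(2d(102(d+1)²Lε_U)² + L^{−d}))`, the adjoint reading, the factorisation of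
# `e^{κM_B} Q†(a•Q) e^{−κM_B}`, and `‖e^{κM_B} Δ′ e^{−κM_B} − Δ′‖ ≤ 8‖κ‖ι·p_K` — the `dQ` ∕ `dQ′` ∕ `dK` conjuncts DISPLAYED (uniformly over `χ, χ′, M_B,
# M_S, M_F` and the circle `‖κ‖ = r`) by ne9-leaf-03's `B9Eq326DeltaABlockDecay.norm_block_G1ofU_le` ((GBD) v2, the `L²` block decay of `G₁ = Δ_a⁻¹`),
# `B9Eq3126QG1QInvPointDecay`, `B9Eq3126H1BlockDecay(OfLetters)` and by this lineage's (D0-d) `B9Eq326LocalPartBlockDecay`, INHABITED at print's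
# one-step vector averaging `Q := QtorusW` from gen 93's two-block letters (`B9Eq349ConjugatedQLetters`) and (3.69)'s conjugation letter
# (`B9Eq369CurvFormConjugation`)

statement-level skeleton of published theorems with citation tags; proofs where landed; nothing here is a claim about the Yang–Mills mass gap

CITATION HEADER (lean-in-tree rule).  Audit cell `pub-balaban`, sub-cell `t4`, BINDER row NE9; filed by the NE9 BINDER-row OWNER lineage
`b2b-balaban-t4-ne9-p1` (gen 94).  Imports this lineage's `B9Eq349ConjugatedQLetters` (gen 93: `norm_conj_QtorusW_sub_le`, `norm_conj_adjoint_QtorusW_sub_le`,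
`conj_QadjQ_factor` — stated with the TWO-BLOCK reading `|χ′(c₋) − χ(b₋)| ≤ ℓ″` for `b₋ ∈ B(c₋) ∪ B(c₊)`), `B9Eq369CurvFormConjugation` (gen 93:
`norm_conj_curvOp_sub_le`) and road B8″'s (G) `B9Eq3101ExpPointwiseMultiplier` (`equiv_exp_smul_apply_complex`, `…_neg_…`: the operator exponential
`exp(κ•M)` of a pointwise multiplier acts pointwise as `e^{κχ}`); through them `B9Eq315QTorus` (`QtorusW` = print's one-step `Q(U)` of (3.15) on the
chain's carriers), `B9Eq319QprimeTorus` (`blockCoord`, `blockOf`, `centre`), `B9SectCLatticeCarrier` (`shift`, `Bond`).  Sources READ first-hand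
(`paper:balaban1985-cmp99-background-propagators`, journal page = PDF page + 388): p. 393 (3.15)–(3.16), p. 399 (3.49), p. 404 (3.69), p. 414
(3.101)–(3.103).  Print never conjugates `Q(U)` (its decay comes from the random walk of Sect. C); the conjugation is the ROUTE's Combes–Thomas substitute
and every constant below is the cell's, not print's.

WHY THIS FILE.  The crew's block-decay ENDs quantify their `Q`-letters over ONE-block companions `χ′` (the shape produced by the pair weights of
`B9Eq349BlockDistanceWeight.exists_pairWeight` ∕ `B9Eq349BondBlockDecayFromCircle`), while the vector averaging `Q(U)` is only SEMI-local ((122)'s straight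
contours leave the block: `(Q(U)A)(c)` reads `A` on `B(c₋) ∪ B(c₊)`), so gen 93's letter needs the TWO-block reading.  §1 closes the gap by [folklore]
lattice geometry: the centres of two neighbouring blocks are joined by the straight fine path of `L` bonds (`centre(y + e_μ) = (· + e_μ)^{L}(centre y)`),
whence `|χ′(c₋) − χ(b₋)| ≤ 3ℓ′ + Lι` on `B(c₊)` (one-block at the two centres + the path + one-block at `c₊`).

WHAT IS PROVED (sorry-free; proof lane — no `def`; [folklore] lattice geometry, finite sums and Hilbert-space plumbing BY NAME; nothing of [B9] asserted).
* §1 `iterate_shift_apply_val_self` ∕ `iterate_shift_apply_ne` (coordinates of `(· + e_μ)^{n} x`), **`centre_shift_eq_iterate`** (`centre L m (y + e_μ) =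
  (· + e_μ)^{L} (centre L m y)`), `abs_sub_iterate_shift_le` (`|χ x − χ((· + e_μ)^{n}x)| ≤ nι`), **`abs_companion_two_block_le`** (`|χ′(c₋) − χ(b₋)| ≤ 3ℓ′ + Lι`
  whenever `B(b₋) ∈ {c₋, c₊}`).
* §2 `exp_neg_apply_exp` (`exp(κ•(−M))(exp(κ•M)g) = g` for a pointwise multiplier `M`).
* §3 at `Q := QtorusW L m hL φ U hα1 hU1 hreg` (print's (3.15), the (3.35)-type letters `hα1 hU1 hreg` + flat twins + `‖U(b) − 1‖ ≤ ε_U` displayed as in gen 93):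
  **`norm_expConj_QtorusW_sub_le`** (`dQ`): `‖exp(κ•M_F)(Q(exp(κ•(−M_B))f)) − Qf‖ ≤ 2(‖κ‖(3ℓ′+Lι))·M_φ′M_φ·√(2(c₁∕c₀)(2d(102(d+1)²Lε_U)² + (L^d)⁻¹))·‖f‖`;
  **`norm_expConj_adjoint_QtorusW_sub_le`** (`dQ′`, same constant); **`exists_expConj_Q_letters`** (the `∃ Q_κ Q′_κ` bundle `hQfac ∧ dQ ∧ dQ′` of
  (D0-c)∕(D0-d) §1∕(CDA) with `Q_κ := exp(κ•M_F)∘Q∘exp(κ•(−M_B))`, `Q′_κ := exp(κ•M_B)∘Q†∘exp(κ•(−M_F))`).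
* §4 **`norm_expConj_curvOp_sub_le`** (`dK`): `‖exp(κ•M_B)(Δ′(exp(κ•(−M_B))f)) − Δ′f‖ ≤ 8(‖κ‖ι)·p_K·‖f‖`, `p_K = 768·|DirPair d|·M_τ·M_φ²·(‖η^d‖∕c₀)·‖η⁻¹‖²·δ`,
  for backgrounds with `U(b) ∈ U1`, trace datum `‖τ(XY)‖ ≤ M_τ‖X‖‖Y‖`, `*`-compatible fibre, plaquette smallness `δ`, window `‖κ‖ι ≤ 1`.
* §5 **`expConj_letters_linear`** — `dQ ∧ dQ′ ∧ dK` at `‖κ‖ = r` with the slopes `N_β := 2(3ℓ′+Lι)·M_φ′M_φ·√(…)`, `N_K := 8ι·p_K` (the first three conjuncts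
  of the `hQK` binder of ne9-leaf-03's `∃`-first ENDs `B9Eq3126H1BlockDecayUniformRadius(Tower)`, letters «linearly in the radius»).
HONEST SCOPE.  One step; crude constants; the MODEL letters stay displayed; nothing of [B9] Thm 3.1∕3.3∕3.11 asserted, valued or discharged; «NE9 ⇐ the
named binders»; NE9 NOT PRINTED ∕ NOT PROVED; row WALLED ON A MODEL (O-NE9-1; #5 UNRULED); spine PROVED 0∕9; rung (B)+1 on a finite T⁴ — NOT infinite volume,
NOT mass gap, NOT BetaPertH, NOT Clay.  HONEST DEPENDENCY: continuum YM on T⁴ ⇐ BetaPertH ∧ nine spine estimates (0/9 proved); BetaPertH ⇐ (D1) ∧ (D4) ∧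
CAP+tail.  NEW file; nothing modified.  Net new unproved facts: 0.
-/

noncomputable section

set_option autoImplicit false

open scoped InnerProductSpace ComplexConjugate BigOperators
open NormedSpace

namespace Literature.MathematicalPhysics.QuantumFieldTheory.Balaban1983to89.B9Eq349ConjugatedQLettersCompanion

open B4Sect5Torus (TSite)
open B9SectCLatticeCarrier (Bond DirPair bpos btgt shift shift_apply_val shift_apply_ne)
open B7Prop1Explicit (U1 Wcx boxVec)
open B9Eq319QprimeTorus (fineP blockCoord centre mem_blockOf_iff blockCoord_centre centre_mem_blockOf)
open B9Eq311L2Pairing (WL2)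
open B11Eq103H1Complex (BondL2K)
open B9Eq310DeltaPrime (reHol imHol)
open B9Eq310HessianOperator (curvOp)
open B9Eq315QTorus (perCfg cornerSite QtorusW)
open B9Eq349ConjugatedQLetters (norm_conj_QtorusW_sub_le norm_conj_adjoint_QtorusW_sub_le conj_QadjQ_factor)
open B9Eq369CurvFormConjugation (norm_conj_curvOp_sub_le)
open B9Eq3101ExpPointwiseMultiplier (equiv_exp_smul_apply_complex equiv_exp_smul_neg_apply_complex)

/-! ## §1 Lattice geometry: the straight fine path between neighbouring centres; the two-block reading of a one-block companion -/

section Geometry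

variable {d : ℕ}

/-- The `μ`-coordinate of `(· + e_μ)^{n} x` is `(x_μ + n) mod P_μ`. [folklore] [cite: Balaban1985Averaging, (2) p.17] -/
theorem iterate_shift_apply_val_self {P : Fin d → ℕ} (μ : Fin d) (x : TSite d P) (n : ℕ) :
    (((shift μ)^[n] x) μ : ℕ) = ((x μ : ℕ) + n) % P μ := by
  induction n with
  | zero => simp [Nat.mod_eq_of_lt (x μ).isLt]
  | succ n ih => rw [Function.iterate_succ_apply', shift_apply_val, ih, Nat.mod_add_mod, Nat.add_assoc]

/-- The other coordinates of `(· + e_μ)^{n} x` are those of `x`. [folklore] [cite: Balaban1985Averaging, (2) p.17] -/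
theorem iterate_shift_apply_ne {P : Fin d → ℕ} {μ i : Fin d} (h : i ≠ μ) (x : TSite d P) (n : ℕ) : ((shift μ)^[n] x) i = x i := by
  induction n with
  | zero => rfl
  | succ n ih => rw [Function.iterate_succ_apply', shift_apply_ne h, ih]

/-- **THE CENTRES OF NEIGHBOURING BLOCKS ARE JOINED BY THE STRAIGHT FINE PATH OF `L` BONDS: `centre L m (y + e_μ) = (· + e_μ)^{L} (centre L m y)`**
(`L·((y_μ + 1) mod m_μ) = (L·y_μ + L) mod (L·m_μ)`). [folklore] [cite: Balaban1985Averaging, (2) p.17] -/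
theorem centre_shift_eq_iterate (L : ℕ) [NeZero L] (m : Fin d → ℕ) (μ : Fin d) (y : TSite d m) :
    centre L m (shift μ y) = (shift μ)^[L] (centre L m y) := by
  funext i
  apply Fin.ext
  by_cases h : i = μ
  · subst h
    rw [iterate_shift_apply_val_self, B9Eq319QprimeTorus.centre_apply_val, B9Eq319QprimeTorus.centre_apply_val, shift_apply_val]
    show L * (((y i : ℕ) + 1) % m i) = (L * (y i : ℕ) + L) % (L * m i)
    rw [← Nat.mul_mod_mul_left, Nat.mul_add, Nat.mul_one]
  · rw [iterate_shift_apply_ne h, B9Eq319QprimeTorus.centre_apply_val, B9Eq319QprimeTorus.centre_apply_val, shift_apply_ne h]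

/-- **`|χ x − χ((· + e_μ)^{n} x)| ≤ n·ι` for a weight with bond increments `≤ ι`** (the bonds `((· + e_μ)^{j}x, μ)`, `j < n`). [folklore]
[cite: Balaban1985BackgroundPropagators, (3.49) p.399, (3.101) p.414] -/
theorem abs_sub_iterate_shift_le {P : Fin d → ℕ} (χ : TSite d P → ℝ) {ι : ℝ} (hχ : ∀ b : Bond d P, |χ (bpos b) - χ (btgt b)| ≤ ι)
    (x : TSite d P) (μ : Fin d) (n : ℕ) : |χ x - χ ((shift μ)^[n] x)| ≤ n * ι := by
  induction n with
  | zero => simp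
  | succ n ih =>
    have hb := hχ ((shift μ)^[n] x, μ)
    rw [Function.iterate_succ_apply', Nat.cast_succ, add_mul, one_mul]
    exact (abs_sub_le _ (χ ((shift μ)^[n] x)) _).trans (add_le_add ih hb)

/-- **THE TWO-BLOCK READING OF A ONE-BLOCK COMPANION: `|χ′(c₋) − χ(b₋)| ≤ 3ℓ′ + L·ι` whenever `b₋ ∈ B(c₋) ∪ B(c₊)`** — on `B(c₋)` the companion reading
itself; on `B(c₊)` (`c₊ = c₋ + e_μ`): `χ′(c₋) → χ(centre c₋)` (one block) `→ χ(centre c₊)` (the straight path of `L` bonds, `centre_shift_eq_iterate`) `→ χ′(c₊)`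
(one block) `→ χ(b₋)` (one block). [folklore] [cite: Balaban1985BackgroundPropagators, (3.49) p.399, (3.83) p.407, (3.101) p.414] -/
theorem abs_companion_two_block_le (L : ℕ) [NeZero L] (m : Fin d → ℕ) (χ : TSite d (fineP L m) → ℝ) (χ' : TSite d m → ℝ) {ι ℓ' : ℝ}
    (hι : 0 ≤ ι) (hℓ' : 0 ≤ ℓ') (hχ : ∀ b : Bond d (fineP L m), |χ (bpos b) - χ (btgt b)| ≤ ι)
    (hχ' : ∀ (y : TSite d m), ∀ x ∈ B9Eq319QprimeTorus.blockOf L m y, |χ' y - χ x| ≤ ℓ')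
    (c : Bond d m) (b : Bond d (fineP L m)) (hb : blockCoord L m b.1 = c.1 ∨ blockCoord L m b.1 = shift c.2 c.1) :
    |χ' c.1 - χ b.1| ≤ 3 * ℓ' + L * ι := by
  have hL0 : (0 : ℝ) ≤ L := Nat.cast_nonneg _
  rcases hb with hb | hb
  · have h1 := hχ' c.1 b.1 ((mem_blockOf_iff L m c.1 b.1).mpr hb)
    nlinarith
  · have h1 : |χ' c.1 - χ (centre L m c.1)| ≤ ℓ' := hχ' c.1 _ (centre_mem_blockOf L m c.1)
    have h2 : |χ (centre L m c.1) - χ (centre L m (shift c.2 c.1))| ≤ L * ι := by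
      rw [centre_shift_eq_iterate]; exact abs_sub_iterate_shift_le χ hχ _ c.2 L
    have h3 : |χ' (shift c.2 c.1) - χ (centre L m (shift c.2 c.1))| ≤ ℓ' := hχ' _ _ (centre_mem_blockOf L m _)
    have h4 : |χ' (shift c.2 c.1) - χ b.1| ≤ ℓ' := hχ' _ b.1 ((mem_blockOf_iff L m _ b.1).mpr hb)
    have h3' : |χ (centre L m (shift c.2 c.1)) - χ' (shift c.2 c.1)| ≤ ℓ' := by rw [abs_sub_comm]; exact h3
    calc |χ' c.1 - χ b.1| ≤ |χ' c.1 - χ (centre L m c.1)| + |χ (centre L m c.1) - χ b.1| := abs_sub_le _ _ _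
      _ ≤ |χ' c.1 - χ (centre L m c.1)| + (|χ (centre L m c.1) - χ (centre L m (shift c.2 c.1))| +
          (|χ (centre L m (shift c.2 c.1)) - χ' (shift c.2 c.1)| + |χ' (shift c.2 c.1) - χ b.1|)) :=
          add_le_add le_rfl ((abs_sub_le _ _ _).trans (add_le_add le_rfl (abs_sub_le _ _ _)))
      _ ≤ ℓ' + (L * ι + (ℓ' + ℓ')) := by gcongr
      _ = 3 * ℓ' + L * ι := by ring

end Geometry

/-! ## §2 The operator exponential of a pointwise multiplier and its inverse -/

section Exp

variable {X : Type*} [Fintype X] {w : X → ℝ} [Fact (∀ x, 0 < w x)] {V : Type*} [NormedAddCommGroup V] [InnerProductSpace ℂ V]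
  [FiniteDimensional ℂ V]

/-- **`exp(κ•(−M))(exp(κ•M)g) = g`** for a pointwise multiplier `M` (both act pointwise, `e^{−κχ}e^{κχ} = 1`). [folklore]
[cite: Balaban1985BackgroundPropagators, (3.49) p.399] -/
theorem exp_neg_apply_exp (M : WL2 ℂ w V →L[ℂ] WL2 ℂ w V) (χ : X → ℝ)
    (hM : ∀ (f : WL2 ℂ w V) (x : X), WL2.equiv ℂ w V (M f) x = (χ x : ℂ) • WL2.equiv ℂ w V f x) (κ : ℂ) (g : WL2 ℂ w V) :
    exp (κ • (-M)) (exp (κ • M) g) = g := by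
  apply (WL2.equiv ℂ w V).injective
  funext x
  rw [equiv_exp_smul_neg_apply_complex M χ hM κ, equiv_exp_smul_apply_complex M χ hM κ, smul_smul, ← Complex.exp_add, neg_add_cancel,
    Complex.exp_zero, one_smul]

/-- **`exp(κ•M)(exp(κ•(−M))g) = g`**. [folklore] [cite: Balaban1985BackgroundPropagators, (3.49) p.399] -/
theorem exp_apply_exp_neg (M : WL2 ℂ w V →L[ℂ] WL2 ℂ w V) (χ : X → ℝ)
    (hM : ∀ (f : WL2 ℂ w V) (x : X), WL2.equiv ℂ w V (M f) x = (χ x : ℂ) • WL2.equiv ℂ w V f x) (κ : ℂ) (g : WL2 ℂ w V) :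
    exp (κ • M) (exp (κ • (-M)) g) = g := by
  apply (WL2.equiv ℂ w V).injective
  funext x
  rw [equiv_exp_smul_apply_complex M χ hM κ, equiv_exp_smul_neg_apply_complex M χ hM κ, smul_smul, ← Complex.exp_add, add_neg_cancel,
    Complex.exp_zero, one_smul]

end Exp

/-! ## §3 The `Q(U)` letters at the operator exponentials, companion shape -/

section QLetters

variable {d : ℕ} (L : ℕ) (m : Fin d → ℕ) [∀ i, NeZero (fineP L m i)] [NeZero L]
  {𝔸 : Type*} [NormedRing 𝔸] [NormedAlgebra ℂ 𝔸] [CompleteSpace 𝔸] [NormOneClass 𝔸] (hL : 1 ≤ L)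
  (U : Bond d (fineP L m) → 𝔸ˣ) {α : ℝ} (hα1 : α ≤ 1 / 64)
  (hU1 : ∀ (x : B7Prop1Explicit.Site d) (κ : Fin d), perCfg (fineP L m) U x κ ∈ U1 𝔸)
  (hreg : ∀ (y : TSite d m) (κ : Fin d) (r : Fin d → Fin L),
    ‖((Wcx L (perCfg (fineP L m) U) (cornerSite L y) κ (boxVec L r) : 𝔸ˣ) : 𝔸) - 1‖ ≤ α)
  {α' : ℝ} (hα1' : α' ≤ 1 / 64)
  (hU1' : ∀ (x : B7Prop1Explicit.Site d) (κ : Fin d), perCfg (fineP L m) (fun _ : Bond d (fineP L m) => (1 : 𝔸ˣ)) x κ ∈ U1 𝔸)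
  (hreg' : ∀ (y : TSite d m) (κ : Fin d) (r : Fin d → Fin L),
    ‖((Wcx L (perCfg (fineP L m) (fun _ : Bond d (fineP L m) => (1 : 𝔸ˣ))) (cornerSite L y) κ (boxVec L r) : 𝔸ˣ) : 𝔸) - 1‖ ≤ α')
  {εU : ℝ} (hεU : 0 ≤ εU) (hUε : ∀ b : Bond d (fineP L m), ‖(U b : 𝔸) - 1‖ ≤ εU)
  {W : Type*} [NormedAddCommGroup W] [InnerProductSpace ℂ W] [FiniteDimensional ℂ W] (φ : W ≃ₗ[ℂ] 𝔸) {c₀ c₁ : ℝ}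
  [Fact (0 < c₀)] [Fact (0 < c₁)]
  {Mφ Mφ' : ℝ} (hMφ : 0 ≤ Mφ) (hφ : ∀ w, ‖φ w‖ ≤ Mφ * ‖w‖) (hMφ' : 0 ≤ Mφ') (hφ' : ∀ X, ‖φ.symm X‖ ≤ Mφ' * ‖X‖)
  {χ : TSite d (fineP L m) → ℝ} {χ' : TSite d m → ℝ} {ι ℓ' : ℝ} (hι : 0 ≤ ι) (hℓ' : 0 ≤ ℓ')
  (hχ : ∀ b : Bond d (fineP L m), |χ (bpos b) - χ (btgt b)| ≤ ι)
  (hχ' : ∀ (y : TSite d m), ∀ x ∈ B9Eq319QprimeTorus.blockOf L m y, |χ' y - χ x| ≤ ℓ')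
  {MB : BondL2K ℂ d (fineP L m) c₀ W →L[ℂ] BondL2K ℂ d (fineP L m) c₀ W}
  (hMB : ∀ (g : BondL2K ℂ d (fineP L m) c₀ W) (b : Bond d (fineP L m)),
    WL2.equiv ℂ (fun _ : Bond d (fineP L m) => c₀) W (MB g) b = (χ (bpos b) : ℂ) • WL2.equiv ℂ (fun _ : Bond d (fineP L m) => c₀) W g b)
  {MF : BondL2K ℂ d m c₁ W →L[ℂ] BondL2K ℂ d m c₁ W}
  (hMF : ∀ (g : BondL2K ℂ d m c₁ W) (c : Bond d m),
    WL2.equiv ℂ (fun _ : Bond d m => c₁) W (MF g) c = (χ' (bpos c) : ℂ) • WL2.equiv ℂ (fun _ : Bond d m => c₁) W g c)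
  {κ : ℂ} (hwin : ‖κ‖ * (3 * ℓ' + L * ι) ≤ 1)

include hα1' hU1' hreg' hεU hUε hMφ hφ hMφ' hφ' hι hℓ' hχ hχ' hMB hMF hwin in
/-- **`dQ` IN THE COMPANION SHAPE: `‖exp(κ•M_F)(Q(U)(exp(κ•(−M_B))f)) − Q(U)f‖ ≤ 2(‖κ‖(3ℓ′+Lι))·M_φ′M_φ·√(2(c₁∕c₀)(2d(102(d+1)²Lε_U)² + (L^d)⁻¹))·‖f‖`** —
gen 93's `norm_conj_QtorusW_sub_le` at the two-block constant `3ℓ′ + Lι` of §1, the exponentials acting pointwise by (G).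
[cite: Balaban1985BackgroundPropagators, (3.15)–(3.16) p.393, (3.49) p.399, (3.83) p.407, (3.101) p.414] -/
theorem norm_expConj_QtorusW_sub_le (f : BondL2K ℂ d (fineP L m) c₀ W) :
    ‖exp (κ • MF) (QtorusW L m hL φ U hα1 hU1 hreg (c₁ := c₁) (exp (κ • (-MB)) f)) - QtorusW L m hL φ U hα1 hU1 hreg (c₁ := c₁) f‖ ≤
      2 * (‖κ‖ * (3 * ℓ' + L * ι)) * (Mφ' * Mφ * Real.sqrt (2 * (c₁ / c₀) * (2 * d * (102 * (d + 1) ^ 2 * L * εU) ^ 2 + ((L : ℝ) ^ d)⁻¹))) * ‖f‖ := by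
  have h2 := abs_companion_two_block_le L m χ χ' hι hℓ' hχ hχ'
  have h := norm_conj_QtorusW_sub_le L m hL U hα1 hU1 hreg hα1' hU1' hreg' hεU hUε φ (c₀ := c₀) (c₁ := c₁) hMφ hφ hMφ' hφ' (by positivity) h2 hwin
    (Sinv := ((exp (κ • (-MB)) : BondL2K ℂ d (fineP L m) c₀ W →L[ℂ] BondL2K ℂ d (fineP L m) c₀ W) :
      BondL2K ℂ d (fineP L m) c₀ W →ₗ[ℂ] BondL2K ℂ d (fineP L m) c₀ W))
    (fun g b => equiv_exp_smul_neg_apply_complex MB (fun b => χ (bpos b)) hMB κ g b)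
    (SF := ((exp (κ • MF) : BondL2K ℂ d m c₁ W →L[ℂ] BondL2K ℂ d m c₁ W) : BondL2K ℂ d m c₁ W →ₗ[ℂ] BondL2K ℂ d m c₁ W))
    (fun g c => equiv_exp_smul_apply_complex MF (fun c => χ' (bpos c)) hMF κ g c) f
  simpa only [ContinuousLinearMap.coe_coe] using h

include hα1' hU1' hreg' hεU hUε hMφ hφ hMφ' hφ' hι hℓ' hχ hχ' hMB hMF hwin in
/-- **`dQ′` IN THE COMPANION SHAPE: `‖exp(κ•M_B)(Q(U)†(exp(κ•(−M_F))g)) − Q(U)†g‖ ≤` the same constant `× ‖g‖`** — gen 93's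
`norm_conj_adjoint_QtorusW_sub_le`. [cite: Balaban1985BackgroundPropagators, (3.15)–(3.16) p.393, (3.26) p.395, (3.49) p.399, (3.101) p.414] -/
theorem norm_expConj_adjoint_QtorusW_sub_le (g : BondL2K ℂ d m c₁ W) :
    ‖exp (κ • MB) (LinearMap.adjoint (QtorusW L m hL φ U hα1 hU1 hreg (c₀ := c₀) (c₁ := c₁)) (exp (κ • (-MF)) g)) -
        LinearMap.adjoint (QtorusW L m hL φ U hα1 hU1 hreg (c₀ := c₀) (c₁ := c₁)) g‖ ≤
      2 * (‖κ‖ * (3 * ℓ' + L * ι)) * (Mφ' * Mφ * Real.sqrt (2 * (c₁ / c₀) * (2 * d * (102 * (d + 1) ^ 2 * L * εU) ^ 2 + ((L : ℝ) ^ d)⁻¹))) * ‖g‖ := by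
  have h2 := abs_companion_two_block_le L m χ χ' hι hℓ' hχ hχ'
  have h := norm_conj_adjoint_QtorusW_sub_le L m hL U hα1 hU1 hreg hα1' hU1' hreg' hεU hUε φ (c₀ := c₀) (c₁ := c₁) hMφ hφ hMφ' hφ' (by positivity)
    h2 hwin
    (S := ((exp (κ • MB) : BondL2K ℂ d (fineP L m) c₀ W →L[ℂ] BondL2K ℂ d (fineP L m) c₀ W) :
      BondL2K ℂ d (fineP L m) c₀ W →ₗ[ℂ] BondL2K ℂ d (fineP L m) c₀ W))
    (fun f b => equiv_exp_smul_apply_complex MB (fun b => χ (bpos b)) hMB κ f b)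
    (SFinv := ((exp (κ • (-MF)) : BondL2K ℂ d m c₁ W →L[ℂ] BondL2K ℂ d m c₁ W) : BondL2K ℂ d m c₁ W →ₗ[ℂ] BondL2K ℂ d m c₁ W))
    (fun g' c => equiv_exp_smul_neg_apply_complex MF (fun c => χ' (bpos c)) hMF κ g' c) g
  simpa only [LinearMap.comp_apply, ContinuousLinearMap.coe_coe] using h

include hα1' hU1' hreg' hεU hUε hMφ hφ hMφ' hφ' hι hℓ' hχ hχ' hMB hMF hwin in
/-- **THE THREE `Q`-LETTERS BUNDLED IN THE `∃ Q_κ Q′_κ` SHAPE** of `B9Eq326ConjugatedLocalPart.norm_conjLocalInv_le` ∕ (D0-d) §1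
`B9Eq326LocalPartBlockDecay.norm_conjLocalInv_le_of_circle` (`hQK`, first conjunct) ∕ ne9-leaf-03's `B9Eq326ConjugatedDeltaA.norm_conjG1ofU_le`: with
`Q_κ := exp(κ•M_F)∘Q(U)∘exp(κ•(−M_B))`, `Q′_κ := exp(κ•M_B)∘Q(U)†∘exp(κ•(−M_F))` — the factorisation `exp(κ•M_B)(Q†(a•Q(exp(κ•(−M_B))f))) = a•Q′_κ(Q_κf)`
(`exp(κ•(−M_F))exp(κ•M_F) = 1`, §2) and the two bounds above. [cite: Balaban1985BackgroundPropagators, (3.15) p.393, (3.26) p.395, (3.49) p.399, (3.101) p.414] -/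
theorem exists_expConj_Q_letters (a : ℝ) :
    ∃ (Qk : BondL2K ℂ d (fineP L m) c₀ W →ₗ[ℂ] BondL2K ℂ d m c₁ W) (Qk' : BondL2K ℂ d m c₁ W →ₗ[ℂ] BondL2K ℂ d (fineP L m) c₀ W),
      (∀ f, exp (κ • MB) (LinearMap.adjoint (QtorusW L m hL φ U hα1 hU1 hreg (c₀ := c₀) (c₁ := c₁))
          (((a : ℝ) : ℂ) • QtorusW L m hL φ U hα1 hU1 hreg (c₁ := c₁) (exp (κ • (-MB)) f))) = ((a : ℝ) : ℂ) • Qk' (Qk f)) ∧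
      (∀ f, ‖Qk f - QtorusW L m hL φ U hα1 hU1 hreg (c₁ := c₁) f‖ ≤
        2 * (‖κ‖ * (3 * ℓ' + L * ι)) * (Mφ' * Mφ * Real.sqrt (2 * (c₁ / c₀) * (2 * d * (102 * (d + 1) ^ 2 * L * εU) ^ 2 + ((L : ℝ) ^ d)⁻¹))) * ‖f‖) ∧
      (∀ g, ‖Qk' g - LinearMap.adjoint (QtorusW L m hL φ U hα1 hU1 hreg (c₀ := c₀) (c₁ := c₁)) g‖ ≤
        2 * (‖κ‖ * (3 * ℓ' + L * ι)) * (Mφ' * Mφ * Real.sqrt (2 * (c₁ / c₀) * (2 * d * (102 * (d + 1) ^ 2 * L * εU) ^ 2 + ((L : ℝ) ^ d)⁻¹))) * ‖g‖) := by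
  have hinv : ∀ g : BondL2K ℂ d m c₁ W, exp (κ • (-MF)) (exp (κ • MF) g) = g := exp_neg_apply_exp MF (fun c => χ' (bpos c)) hMF κ
  refine ⟨((exp (κ • MF) : BondL2K ℂ d m c₁ W →L[ℂ] BondL2K ℂ d m c₁ W) : BondL2K ℂ d m c₁ W →ₗ[ℂ] BondL2K ℂ d m c₁ W) ∘ₗ
      QtorusW L m hL φ U hα1 hU1 hreg (c₁ := c₁) ∘ₗ
      ((exp (κ • (-MB)) : BondL2K ℂ d (fineP L m) c₀ W →L[ℂ] BondL2K ℂ d (fineP L m) c₀ W) :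
        BondL2K ℂ d (fineP L m) c₀ W →ₗ[ℂ] BondL2K ℂ d (fineP L m) c₀ W),
    ((exp (κ • MB) : BondL2K ℂ d (fineP L m) c₀ W →L[ℂ] BondL2K ℂ d (fineP L m) c₀ W) :
        BondL2K ℂ d (fineP L m) c₀ W →ₗ[ℂ] BondL2K ℂ d (fineP L m) c₀ W) ∘ₗ
      LinearMap.adjoint (QtorusW L m hL φ U hα1 hU1 hreg (c₀ := c₀) (c₁ := c₁)) ∘ₗ
      ((exp (κ • (-MF)) : BondL2K ℂ d m c₁ W →L[ℂ] BondL2K ℂ d m c₁ W) : BondL2K ℂ d m c₁ W →ₗ[ℂ] BondL2K ℂ d m c₁ W),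
    fun f => ?_, fun f => ?_, fun g => ?_⟩
  · simp only [LinearMap.comp_apply, ContinuousLinearMap.coe_coe, hinv, map_smul]
  · simpa only [LinearMap.comp_apply, ContinuousLinearMap.coe_coe] using
      norm_expConj_QtorusW_sub_le L m hL U hα1 hU1 hreg hα1' hU1' hreg' hεU hUε φ hMφ hφ hMφ' hφ' hι hℓ' hχ hχ' hMB hMF hwin f
  · simpa only [LinearMap.comp_apply, ContinuousLinearMap.coe_coe] using
      norm_expConj_adjoint_QtorusW_sub_le L m hL U hα1 hU1 hreg hα1' hU1' hreg' hεU hUε φ hMφ hφ hMφ' hφ' hι hℓ' hχ hχ' hMB hMF hwin g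

end QLetters

/-! ## §4 The `Δ′(U)` letter at the operator exponentials -/

section KLetter

variable {d : ℕ} {Pd : Fin d → ℕ} {𝔸 : Type*} [NormedRing 𝔸] [StarRing 𝔸] [NormedAlgebra ℂ 𝔸] [StarModule ℂ 𝔸] [NormOneClass 𝔸]
  {W : Type*} [NormedAddCommGroup W] [InnerProductSpace ℂ W] [FiniteDimensional ℂ W] (φ : W ≃ₗ[ℂ] 𝔸) {Mφ : ℝ}
  (hφ : ∀ w, ‖φ w‖ ≤ Mφ * ‖w‖) (hMφ : 0 ≤ Mφ) (hstar : ∀ X : 𝔸, ‖star X‖ ≤ ‖X‖)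
  {c₀ : ℝ} [Fact (0 < c₀)] (τ : 𝔸 →ₗ[ℂ] ℂ) {Mτ : ℝ} (hτ : ∀ X Y : 𝔸, ‖τ (X * Y)‖ ≤ Mτ * ‖X‖ * ‖Y‖) (hMτ : 0 ≤ Mτ)
  (η : ℝ) (U : Bond d Pd → 𝔸ˣ) (hU : ∀ b, U b ∈ U1 𝔸) {δ : ℝ} (hδ : 0 ≤ δ)
  (hRe : ∀ p : B9SectCLatticeCarrier.Plaq d Pd, ‖reHol U p - 1‖ ≤ δ) (hIm : ∀ p : B9SectCLatticeCarrier.Plaq d Pd, ‖imHol U p‖ ≤ δ)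
  {χ : TSite d Pd → ℝ} {ι : ℝ} (hι : 0 ≤ ι) (hχ : ∀ b : Bond d Pd, |χ (bpos b) - χ (btgt b)| ≤ ι)
  {MB : BondL2K ℂ d Pd c₀ W →L[ℂ] BondL2K ℂ d Pd c₀ W}
  (hMB : ∀ (g : BondL2K ℂ d Pd c₀ W) (b : Bond d Pd),
    WL2.equiv ℂ (fun _ : Bond d Pd => c₀) W (MB g) b = (χ (bpos b) : ℂ) • WL2.equiv ℂ (fun _ : Bond d Pd => c₀) W g b)
  {κ : ℂ} (hwinK : ‖κ‖ * ι ≤ 1)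

include hφ hMφ hstar hτ hMτ hU hδ hRe hIm hι hχ hMB hwinK in
/-- **`dK` AT THE OPERATOR EXPONENTIALS: `‖exp(κ•M_B)(Δ′(U)(exp(κ•(−M_B))f)) − Δ′(U)f‖ ≤ 8(‖κ‖ι)·p_K·‖f‖`**,
`p_K = 768·|DirPair d|·M_τ·M_φ²·(‖η^d‖∕c₀)·‖η⁻¹‖²·δ` — gen 93's `norm_conj_curvOp_sub_le` (θ := ι), the exponentials acting pointwise by (G), `U(b) ∈ U1`
read as the pair of norm bounds. [cite: Balaban1985BackgroundPropagators, (3.69) p.404, (3.49) p.399, (3.10) p.392, (3.101) p.414, (3.35) p.396] -/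
theorem norm_expConj_curvOp_sub_le (f : BondL2K ℂ d Pd c₀ W) :
    ‖exp (κ • MB) (curvOp φ τ η U (exp (κ • (-MB)) f)) - curvOp φ τ η U f‖ ≤
      8 * (‖κ‖ * ι) * (768 * Fintype.card (DirPair d) * Mτ * Mφ ^ 2 * (‖((η : ℂ)) ^ d‖ / c₀) * ‖((η : ℂ))⁻¹‖ ^ 2 * δ) * ‖f‖ := by
  have h := norm_conj_curvOp_sub_le φ hφ hMφ hstar τ hτ hMτ η U (fun b => B7Prop1Explicit.mem_U1.mp (hU b)) hδ hRe hIm hι hχ hwinK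
    (S := ((exp (κ • MB) : BondL2K ℂ d Pd c₀ W →L[ℂ] BondL2K ℂ d Pd c₀ W) : BondL2K ℂ d Pd c₀ W →ₗ[ℂ] BondL2K ℂ d Pd c₀ W))
    (Sinv := ((exp (κ • (-MB)) : BondL2K ℂ d Pd c₀ W →L[ℂ] BondL2K ℂ d Pd c₀ W) : BondL2K ℂ d Pd c₀ W →ₗ[ℂ] BondL2K ℂ d Pd c₀ W))
    (fun g b => equiv_exp_smul_apply_complex MB (fun b => χ (bpos b)) hMB κ g b)
    (fun g b => equiv_exp_smul_neg_apply_complex MB (fun b => χ (bpos b)) hMB κ g b) f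
  simpa only [LinearMap.comp_apply, ContinuousLinearMap.coe_coe] using h

end KLetter

/-! ## §5 The three letters together, linear in the radius (the `∃`-first ENDs' shape) -/

section Linear

variable {d : ℕ} (L : ℕ) (m : Fin d → ℕ) [∀ i, NeZero (fineP L m i)] [NeZero L]
  {𝔸 : Type*} [NormedRing 𝔸] [StarRing 𝔸] [NormedAlgebra ℂ 𝔸] [StarModule ℂ 𝔸] [CompleteSpace 𝔸] [NormOneClass 𝔸] (hL : 1 ≤ L)
  (U : Bond d (fineP L m) → 𝔸ˣ) (hU : ∀ b, U b ∈ U1 𝔸) {α : ℝ} (hα1 : α ≤ 1 / 64)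
  (hU1 : ∀ (x : B7Prop1Explicit.Site d) (κ : Fin d), perCfg (fineP L m) U x κ ∈ U1 𝔸)
  (hreg : ∀ (y : TSite d m) (κ : Fin d) (r : Fin d → Fin L),
    ‖((Wcx L (perCfg (fineP L m) U) (cornerSite L y) κ (boxVec L r) : 𝔸ˣ) : 𝔸) - 1‖ ≤ α)
  {α' : ℝ} (hα1' : α' ≤ 1 / 64)
  (hU1' : ∀ (x : B7Prop1Explicit.Site d) (κ : Fin d), perCfg (fineP L m) (fun _ : Bond d (fineP L m) => (1 : 𝔸ˣ)) x κ ∈ U1 𝔸)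
  (hreg' : ∀ (y : TSite d m) (κ : Fin d) (r : Fin d → Fin L),
    ‖((Wcx L (perCfg (fineP L m) (fun _ : Bond d (fineP L m) => (1 : 𝔸ˣ))) (cornerSite L y) κ (boxVec L r) : 𝔸ˣ) : 𝔸) - 1‖ ≤ α')
  {εU : ℝ} (hεU : 0 ≤ εU) (hUε : ∀ b : Bond d (fineP L m), ‖(U b : 𝔸) - 1‖ ≤ εU)
  {W : Type*} [NormedAddCommGroup W] [InnerProductSpace ℂ W] [FiniteDimensional ℂ W] (φ : W ≃ₗ[ℂ] 𝔸) {c₀ c₁ : ℝ}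
  [Fact (0 < c₀)] [Fact (0 < c₁)]
  {Mφ Mφ' : ℝ} (hMφ : 0 ≤ Mφ) (hφ : ∀ w, ‖φ w‖ ≤ Mφ * ‖w‖) (hMφ' : 0 ≤ Mφ') (hφ' : ∀ X, ‖φ.symm X‖ ≤ Mφ' * ‖X‖)
  (hstar : ∀ X : 𝔸, ‖star X‖ ≤ ‖X‖)
  (τ : 𝔸 →ₗ[ℂ] ℂ) {Mτ : ℝ} (hτ : ∀ X Y : 𝔸, ‖τ (X * Y)‖ ≤ Mτ * ‖X‖ * ‖Y‖) (hMτ : 0 ≤ Mτ) (η : ℝ) {δ : ℝ} (hδ : 0 ≤ δ)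
  (hRe : ∀ p : B9SectCLatticeCarrier.Plaq d (fineP L m), ‖reHol U p - 1‖ ≤ δ)
  (hIm : ∀ p : B9SectCLatticeCarrier.Plaq d (fineP L m), ‖imHol U p‖ ≤ δ)
  {ι ℓ' r : ℝ} (hι : 0 ≤ ι) (hℓ' : 0 ≤ ℓ') (hwin : r * (3 * ℓ' + L * ι) ≤ 1) (hwinK : r * ι ≤ 1)
  {χ : TSite d (fineP L m) → ℝ} {χ' : TSite d m → ℝ}
  (hχ : ∀ b : Bond d (fineP L m), |χ (bpos b) - χ (btgt b)| ≤ ι)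
  (hχ' : ∀ (y : TSite d m), ∀ x ∈ B9Eq319QprimeTorus.blockOf L m y, |χ' y - χ x| ≤ ℓ')
  {MB : BondL2K ℂ d (fineP L m) c₀ W →L[ℂ] BondL2K ℂ d (fineP L m) c₀ W}
  (hMB : ∀ (g : BondL2K ℂ d (fineP L m) c₀ W) (b : Bond d (fineP L m)),
    WL2.equiv ℂ (fun _ : Bond d (fineP L m) => c₀) W (MB g) b = (χ (bpos b) : ℂ) • WL2.equiv ℂ (fun _ : Bond d (fineP L m) => c₀) W g b)
  {MF : BondL2K ℂ d m c₁ W →L[ℂ] BondL2K ℂ d m c₁ W}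
  (hMF : ∀ (g : BondL2K ℂ d m c₁ W) (c : Bond d m),
    WL2.equiv ℂ (fun _ : Bond d m => c₁) W (MF g) c = (χ' (bpos c) : ℂ) • WL2.equiv ℂ (fun _ : Bond d m => c₁) W g c)

include hα1' hU1' hreg' hεU hUε hMφ hφ hMφ' hφ' hstar hτ hMτ hU hδ hRe hIm hι hℓ' hwin hwinK hχ hχ' hMB hMF in
/-- **THE `dQ` ∕ `dQ′` ∕ `dK` CONJUNCTS TOGETHER, LINEAR IN THE RADIUS `r = ‖κ‖`** — the first three conjuncts of the `hQK` binder of ne9-leaf-03's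
`∃`-first ENDs (`B9Eq3126H1BlockDecayUniformRadius.exists_rate_block_decay_H1ofU`, `…Tower`) at `Q := QtorusW`, with the slopes
`N_β := 2(3ℓ′ + Lι)·M_φ′M_φ·√(2(c₁∕c₀)(2d(102(d+1)²Lε_U)² + (L^d)⁻¹))`, `N_K := 8ι·p_K`, under the caps `r(3ℓ′ + Lι) ≤ 1`, `rι ≤ 1` (the consumer's `R`);
the fourth conjunct (`dR`, the `R(U)` letter) is the site-averaging lineage's. [cite: Balaban1985BackgroundPropagators, (3.15) p.393, (3.26) p.395, (3.49) p.399,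
(3.69) p.404, (3.101) p.414] -/
theorem expConj_letters_linear (κ : ℂ) (hκ : ‖κ‖ = r) :
    (∀ f, ‖exp (κ • MF) (QtorusW L m hL φ U hα1 hU1 hreg (c₁ := c₁) (exp (κ • (-MB)) f)) - QtorusW L m hL φ U hα1 hU1 hreg (c₁ := c₁) f‖ ≤
        (2 * (3 * ℓ' + L * ι) * (Mφ' * Mφ * Real.sqrt (2 * (c₁ / c₀) * (2 * d * (102 * (d + 1) ^ 2 * L * εU) ^ 2 + ((L : ℝ) ^ d)⁻¹))) * r) * ‖f‖) ∧
      (∀ g, ‖exp (κ • MB) (LinearMap.adjoint (QtorusW L m hL φ U hα1 hU1 hreg (c₀ := c₀) (c₁ := c₁)) (exp (κ • (-MF)) g)) -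
          LinearMap.adjoint (QtorusW L m hL φ U hα1 hU1 hreg (c₀ := c₀) (c₁ := c₁)) g‖ ≤
        (2 * (3 * ℓ' + L * ι) * (Mφ' * Mφ * Real.sqrt (2 * (c₁ / c₀) * (2 * d * (102 * (d + 1) ^ 2 * L * εU) ^ 2 + ((L : ℝ) ^ d)⁻¹))) * r) * ‖g‖) ∧
      (∀ f, ‖exp (κ • MB) (curvOp φ τ η U (exp (κ • (-MB)) f)) - curvOp φ τ η U f‖ ≤
        (8 * ι * (768 * Fintype.card (DirPair d) * Mτ * Mφ ^ 2 * (‖((η : ℂ)) ^ d‖ / c₀) * ‖((η : ℂ))⁻¹‖ ^ 2 * δ) * r) * ‖f‖) := by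
  have hwin' : ‖κ‖ * (3 * ℓ' + L * ι) ≤ 1 := by rw [hκ]; exact hwin
  have hwinK' : ‖κ‖ * ι ≤ 1 := by rw [hκ]; exact hwinK
  refine ⟨fun f => ?_, fun g => ?_, fun f => ?_⟩
  · have h := norm_expConj_QtorusW_sub_le L m hL U hα1 hU1 hreg hα1' hU1' hreg' hεU hUε φ hMφ hφ hMφ' hφ' hι hℓ' hχ hχ' hMB hMF hwin' f
    rw [hκ] at h
    refine h.trans (le_of_eq ?_)
    ring
  · have h := norm_expConj_adjoint_QtorusW_sub_le L m hL U hα1 hU1 hreg hα1' hU1' hreg' hεU hUε φ hMφ hφ hMφ' hφ' hι hℓ' hχ hχ' hMB hMF hwin' g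
    rw [hκ] at h
    refine h.trans (le_of_eq ?_)
    ring
  · have h := norm_expConj_curvOp_sub_le φ hφ hMφ hstar τ hτ hMτ η U hU hδ hRe hIm hι hχ hMB hwinK' f
    rw [hκ] at h
    refine h.trans (le_of_eq ?_)
    ring

end Linear

end Literature.MathematicalPhysics.QuantumFieldTheory.Balaban1983to89.B9Eq349ConjugatedQLettersCompanion

end
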